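/-
Copyright (c) 2026 the pub-hodgecm-mathlib formalisation cell (harness21).  Prover seat hodgecm-mathlib-K2E3-p23 (g4), Track B «K2-LIT» ∕ h413
(`stmt-HodgeConjecture-24833`), line `K2_E3_EllipticInputs`, (SC-an) road «FC» (line lead K2E3-p14 (g4), RULINGS #15 ∕ MAP v5), brick (FC-C).  2026-09-04.
-/
import Mathlib.MeasureTheory.Group.LIntegral
import Mathlib.MeasureTheory.Measure.Prod
import Mathlib.MeasureTheory.Measure.Typeclasses.Probability
import HarnessLib

/-!
# Crux `H413` — K2-LIT E3, (SC-an) road «FC» (finite conjugation measure), brick (FC-C): AVERAGING OVER A SUBGROUP THAT PRESERVES THE DOMAIN OF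
# INTEGRATION — `∫_B f dμ = ∫_B (∫_T f(t·x) dν(t)) dμ(x) ≤ μ(B) · sup_{x ∈ B} ∫_T f(t·x) dν(t)`

Cell `hodgecm-mathlib`, Track B, line `K2_E3_EllipticInputs`, socket U12 :255 (SC-an) via road «FC» of K2E3-p14 (g4) (RULINGS #15, step (v):
left-`T'`-averaging of the near-collision set inside the box `box_d`); seat K2E3-p23 (g4).  THEOREMS ONLY, Mathlib-pure; count-neutral helper
(`--supports stmt-HodgeConjecture-24833 --as helper`).

THE MATHEMATICS (Tonelli + left invariance; nothing else).  `G` a group with a measurable structure in which multiplication is jointly measurable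
(`MeasurableMul₂ G` — automatic for a second-countable Borel topological group), `μ` an s-finite LEFT-invariant measure on `G` (every Haar measure on a
second-countable locally compact group), `T ≤ G` ANY subgroup and `ν` ANY probability measure on `↥T` (the intended use: `T` compact, `ν` its Haar
probability — neither compactness nor invariance of `ν` is needed), `B ⊆ G` measurable with `t • B = B` for all `t ∈ T`, `f ≥ 0` measurable.  For each
`t ∈ T`, `x ↦ t·x` preserves `μ` and `B`, so `∫_B f(t·x) dμ(x) = ∫_B f dμ`; integrating this constant in `t` against `ν` and swapping the integrals:

* `mul_mem_iff_mem` — `t·x ∈ B ↔ x ∈ B` (`t ∈ T`);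
* `setLIntegral_comp_mul_left_eq` — **`∫_B f(t·x) dμ(x) = ∫_B f dμ`** (`t ∈ T`; `μ` left-invariant, any `f`);
* `setLIntegral_eq_setLIntegral_lintegral_subgroup` — **THE AVERAGING IDENTITY `∫_B f dμ = ∫_B ∫_T f(t·x) dν(t) dμ(x)`**;
* `setLIntegral_le_measure_mul_iSup_mem` — **`∫_B f dμ ≤ μ(B) · ⨆_{x ∈ B} ∫_T f(t·x) dν(t)`** (the (FC-C) head, sup over the box only — what step (v) consumes,
  since (FC-5) bounds the fibre measure only for `g` with bounded diagonal); `setLIntegral_le_measure_mul_iSup` — the same with the sup over all of `G`;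
* `measure_inter_le_measure_mul_iSup_mem` — the indicator case **`μ(B ∩ N) ≤ μ(B) · ⨆_{x ∈ B} ν{t | t·x ∈ N}`** (step (v) verbatim: `B = box_d`, `N` = the
  near-collision set, `T = T'`, `ν = λ_{T'}`).

HONEST LABEL: HC_CM is proved only modulo the 7 printed citations (2 remaining named inputs: hLiu418 = stmt-HodgeConjecture-24832, h413 =
stmt-HodgeConjecture-24833) until rung 0 closes; elementary measure theory, closes no organ by itself ((SC-an) is NOT ★; road «FC» pays `hballE` only when
(FC-A)…(FC-8) + (M5h‴) land).

## References
* [Folland1995] G. B. Folland, *A Course in Abstract Harmonic Analysis* (1995), §2.2 (left invariance of the Haar integral), §2.6 (integration over subgroups).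
* [Helgason2000] S. Helgason, *Groups and Geometric Analysis* (2000), Ch. I §1 No. 1–2 (invariant integration, Fubini on groups).
-/

set_option autoImplicit false
-- the mandated namespace repeats `HodgeConjecture.HodgeConjecture`, as in every `Theorems/*.lean` of this sub-problem
set_option linter.dupNamespace false

noncomputable section

open MeasureTheory MeasureTheory.Measure Set Function
open scoped ENNReal Pointwise

namespace Summit.HodgeConjecture.HodgeConjecture.Cruxes.H413.K2E3CompactSubgroupAveraging

variable {G : Type*} [Group G] [MeasurableSpace G]

omit [MeasurableSpace G] in
/-- **`t·x ∈ B ↔ x ∈ B`** for `t` in a subgroup `T` with `t • B = B` for all `t ∈ T`. [folklore] -/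
theorem mul_mem_iff_mem (T : Subgroup G) {B : Set G} (hTB : ∀ t ∈ T, t • B = B) {t : G} (ht : t ∈ T) (x : G) :
    t * x ∈ B ↔ x ∈ B := by
  conv_lhs => rw [← hTB t ht]
  rw [← smul_eq_mul, Set.smul_mem_smul_set_iff]

/-- **`∫_B f(t·x) dμ(x) = ∫_B f dμ`** for `t ∈ T`, `T ≤ G` a subgroup with `t • B = B` (`t ∈ T`), `μ` LEFT-invariant (any `f ≥ 0`): the substitution
`x ↦ t·x` preserves `μ` and `B`. [cite: Folland1995, §2.2] -/
theorem setLIntegral_comp_mul_left_eq [MeasurableMul G] (μ : Measure G) [μ.IsMulLeftInvariant] (T : Subgroup G)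
    {B : Set G} (hBm : MeasurableSet B) (hTB : ∀ t ∈ T, t • B = B) (f : G → ℝ≥0∞) {t : G} (ht : t ∈ T) :
    ∫⁻ x in B, f (t * x) ∂μ = ∫⁻ x in B, f x ∂μ := by
  rw [← lintegral_indicator hBm, ← lintegral_indicator hBm]
  have h : (fun x => B.indicator (fun y => f (t * y)) x) = fun x => B.indicator f (t * x) := by
    funext x
    by_cases hx : x ∈ B
    · rw [Set.indicator_of_mem hx, Set.indicator_of_mem ((mul_mem_iff_mem T hTB ht x).2 hx)]
    · rw [Set.indicator_of_notMem hx, Set.indicator_of_notMem (mt (mul_mem_iff_mem T hTB ht x).1 hx)]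
  rw [h, lintegral_mul_left_eq_self]

/-- **THE AVERAGING IDENTITY `∫_B f dμ = ∫_B (∫_T f(t·x) dν(t)) dμ(x)`** — `μ` s-finite and LEFT-invariant, multiplication jointly measurable, `T ≤ G`
any subgroup, `ν` ANY probability measure on `↥T`, `B` measurable with `t • B = B` (`t ∈ T`), `f ≥ 0` measurable (Tonelli on `↥T × G` + the substitution
`x ↦ t·x`). [cite: Helgason2000, Ch. I §1 No. 2] -/
theorem setLIntegral_eq_setLIntegral_lintegral_subgroup [MeasurableMul₂ G] (μ : Measure G) [SFinite μ] [μ.IsMulLeftInvariant]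
    (T : Subgroup G) (ν : Measure ↥T) [IsProbabilityMeasure ν]
    {B : Set G} (hBm : MeasurableSet B) (hTB : ∀ t ∈ T, t • B = B) {f : G → ℝ≥0∞} (hf : Measurable f) :
    ∫⁻ x in B, f x ∂μ = ∫⁻ x in B, ∫⁻ t, f ((t : G) * x) ∂ν ∂μ := by
  have hF : Measurable (uncurry fun (t : ↥T) (x : G) => f ((t : G) * x)) :=
    hf.comp ((measurable_subtype_coe.comp measurable_fst).mul measurable_snd)
  calc ∫⁻ x in B, f x ∂μ = ∫⁻ _ : ↥T, ∫⁻ x in B, f x ∂μ ∂ν := by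
        rw [lintegral_const, measure_univ, mul_one]
    _ = ∫⁻ t : ↥T, ∫⁻ x in B, f ((t : G) * x) ∂μ ∂ν := by
        refine lintegral_congr fun t => ?_
        rw [setLIntegral_comp_mul_left_eq μ T hBm hTB f t.2]
    _ = ∫⁻ x in B, ∫⁻ t, f ((t : G) * x) ∂ν ∂μ := lintegral_lintegral_swap hF.aemeasurable

/-- **(FC-C) `∫_B f dμ ≤ μ(B) · ⨆_{x ∈ B} ∫_T f(t·x) dν(t)`** — the box-restricted sup (hypotheses as in the averaging identity). [folklore] -/
theorem setLIntegral_le_measure_mul_iSup_mem [MeasurableMul₂ G] (μ : Measure G) [SFinite μ] [μ.IsMulLeftInvariant]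
    (T : Subgroup G) (ν : Measure ↥T) [IsProbabilityMeasure ν]
    {B : Set G} (hBm : MeasurableSet B) (hTB : ∀ t ∈ T, t • B = B) {f : G → ℝ≥0∞} (hf : Measurable f) :
    ∫⁻ x in B, f x ∂μ ≤ μ B * ⨆ x ∈ B, ∫⁻ t, f ((t : G) * x) ∂ν := by
  rw [setLIntegral_eq_setLIntegral_lintegral_subgroup μ T ν hBm hTB hf]
  calc ∫⁻ x in B, ∫⁻ t, f ((t : G) * x) ∂ν ∂μ
      ≤ ∫⁻ _ in B, ⨆ y ∈ B, ∫⁻ t, f ((t : G) * y) ∂ν ∂μ :=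
        setLIntegral_mono' hBm fun x hx => le_iSup₂ (f := fun (y : G) (_ : y ∈ B) => ∫⁻ t, f ((t : G) * y) ∂ν) x hx
    _ = μ B * ⨆ y ∈ B, ∫⁻ t, f ((t : G) * y) ∂ν := by
        rw [setLIntegral_const, mul_comm]

/-- **`∫_B f dμ ≤ μ(B) · ⨆_{x ∈ G} ∫_T f(t·x) dν(t)`** — the literal (FC-C) head of MAP v5 (global sup). [folklore] -/
theorem setLIntegral_le_measure_mul_iSup [MeasurableMul₂ G] (μ : Measure G) [SFinite μ] [μ.IsMulLeftInvariant]
    (T : Subgroup G) (ν : Measure ↥T) [IsProbabilityMeasure ν]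
    {B : Set G} (hBm : MeasurableSet B) (hTB : ∀ t ∈ T, t • B = B) {f : G → ℝ≥0∞} (hf : Measurable f) :
    ∫⁻ x in B, f x ∂μ ≤ μ B * ⨆ x, ∫⁻ t, f ((t : G) * x) ∂ν := by
  refine (setLIntegral_le_measure_mul_iSup_mem μ T ν hBm hTB hf).trans ?_
  exact mul_le_mul' le_rfl (iSup₂_le fun x _ => le_iSup (fun y : G => ∫⁻ t, f ((t : G) * y) ∂ν) x)

/-- **Step (v) verbatim — `μ(B ∩ N) ≤ μ(B) · ⨆_{x ∈ B} ν{t ∈ T | t·x ∈ N}`** for measurable `N` (the near-collision set), `B` the left-`T`-invariant box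
(indicator case of (FC-C)). [folklore] -/
theorem measure_inter_le_measure_mul_iSup_mem [MeasurableMul₂ G] (μ : Measure G) [SFinite μ] [μ.IsMulLeftInvariant]
    (T : Subgroup G) (ν : Measure ↥T) [IsProbabilityMeasure ν]
    {B : Set G} (hBm : MeasurableSet B) (hTB : ∀ t ∈ T, t • B = B) {N : Set G} (hN : MeasurableSet N) :
    μ (B ∩ N) ≤ μ B * ⨆ x ∈ B, ν {t : ↥T | (t : G) * x ∈ N} := by
  have h1 : ∫⁻ x in B, N.indicator 1 x ∂μ = μ (B ∩ N) := by
    rw [lintegral_indicator_one hN, Measure.restrict_apply hN, Set.inter_comm]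
  have h2 : ∀ x : G, ∫⁻ t, N.indicator (1 : G → ℝ≥0∞) ((t : G) * x) ∂ν = ν {t : ↥T | (t : G) * x ∈ N} := by
    intro x
    have hm : MeasurableSet {t : ↥T | (t : G) * x ∈ N} := (measurable_subtype_coe.mul_const x) hN
    rw [← lintegral_indicator_one hm]
    refine lintegral_congr fun t => ?_
    by_cases ht : (t : G) * x ∈ N
    · rw [Set.indicator_of_mem ht, Set.indicator_of_mem (show t ∈ {t : ↥T | (t : G) * x ∈ N} from ht)]; rfl
    · rw [Set.indicator_of_notMem ht, Set.indicator_of_notMem (show t ∉ {t : ↥T | (t : G) * x ∈ N} from ht)]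
  rw [← h1]
  refine (setLIntegral_le_measure_mul_iSup_mem μ T ν hBm hTB (measurable_one.indicator hN)).trans (le_of_eq ?_)
  congr 1
  exact iSup_congr fun x => iSup_congr fun _ => h2 x

end Summit.HodgeConjecture.HodgeConjecture.Cruxes.H413.K2E3CompactSubgroupAveraging

end
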